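import Summits.Ventures.CertifiedQuantumChemistry.Rows.SectorTransferRows
import Summits.Ventures.CertifiedQuantumChemistry.Rows.LinearCombination
import Summits.Ventures.CertifiedQuantumChemistry.Rows.SpinSectors
import Literature.MathematicalPhysics.QuantumChemistry.GeneralizedFockMatrix
import Literature.MathematicalPhysics.QuantumLattice.FermionOperatorsProofs
import HarnessLib

/-!
# Ventures/CertifiedQuantumChemistry — Rows/HoleTransferTable.lean: the HOLE-TRANSFER TABLE FILE
# `K = μ·F + t·𝔾_c − 𝕏_c` of a `dE-direct:s` (vertical-IP) certificate as an exact-rational `Model k`,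
# its symmetries, and the operators it realises (hole transfer `a_{cσ}`, Gram operator `G_c`, the
# commutator operator `O = Σ_σ a†_{cσ}[a_{cσ}, Ĥ]` expanded by HJO (10.8.20))

HONEST FRAMING (verbatim): certified bounds for a stated model Hamiltonian in a stated basis; not a
claim about the real molecule or material beyond that model. `K` is NOT a physical Hamiltonian; it is
DATA for one SDP leg.

Typer chem-type-09 (LADDER-CHEM I-TYPE slot 09 class (s), item (L2) of chem-solver-5's
`solver/diff-sector/DESIGN.md` §4.1/§6; order «hole/particle tables FIRST» per chem-solver-5
2026-08-27T00:16:47Z). The object typed here is the table written by the cell's exact tool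
`solver/diff-sector/tools/fcidump_transfer.py` 0.1.0, class `hole`, for a pinned file `F` on `k`
orbitals, a rational orbital vector `c`, and rationals `μ ≥ 0`, `t`:
* one-body table `μ·h_pq + t·c_p c_q + ½(c_p (ch)_q + c_q (ch)_p)`, `(ch)_q := Σ_n c_n h_nq`;
* two-body table `μ·g_pqrs + 2·B_pqrs`, `B` = the Hermitian-and-pair symmetrisation
  `½·¼·(A_pqrs + A_qpsr + A_rspq + A_srqp)·4/2`… precisely `holeTwoBody = (A_pqrs + A_qpsr + A_rspq + A_srqp)/2`
  of `A_mqrs := c_m Σ_n c_n g_nqrs` (for an 8-fold-symmetric `g` this equals the tool's `2·sym8(A)`: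
  the 4-term average is already invariant under the remaining index swaps);
* core constant `μ·E_core`.

## Contents
* §1 `Model.holeTable c t F` (the `t·𝔾_c − 𝕏_c` part), `Model.transferHole c μ t F :=
  Model.lincomb μ 1 F (holeTable c t F)` (the file `K`), their symmetry
  (`holeTable_isSymmetric`, `transferHole_isSymmetric`: `K` is a legal model for
  `lowerRow_of_certificate`).
* §2 Operators: `holeOp c σ = Σ_q c_q a_{qσ}` (the hole transfer of spin `σ`), `holeGram c =
  Σ_σ holeOp† holeOp` (`= Σ_pq c_p c_q E_pq`, `holeGram_eq`), `holeCommutatorOp c F =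
  Σ_σ holeOp† (holeOp Ĥ(F) − Ĥ(F) holeOp)` (`= Σ_mn c_m c_n (Σ_q h_nq E_mq + Σ_qrs g_nqrs e_mqrs)`,
  HJO (10.8.20), `holeCommutatorOp_eq`).
* `twoElectronExcitation_pairSwap`: `e_pqrs = e_rspq` (two anticommutations; HJO (2.2.16) ff.).
* The operator identity `Ĥ(K) = μ·Ĥ(F) + t·G_c − X_c` and the END-TO-END difference rows are the
  sequel `Rows/HoleTransferRows.lean` (split for size).

What is NOT here: the particle and spin-flip tables (later files); any certificate instance, number
or claim node. Printed neighbours (ESTIMATORS in print, never certificates): the extended Koopmans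
theorem (Morrell–Parr–Levy 1975; Smith–Day 1975) and HJO §10.8.3 eq. (10.8.20) — the operator identity
used is the tree's `sum_creation_mul_commutator_annihilation_hamiltonian`.
[cite: HelgakerJorgensenOlsen2000, eq. (10.8.20)]
-/

noncomputable section

namespace Summit.Ventures.CertifiedQuantumChemistry

open Matrix Finset
open Literature.MathematicalPhysics.QuantumLattice Literature.MathematicalPhysics.QuantumChemistry
open Literature.MathematicalPhysics.QuantumLattice.EigenvalueContinuation
open scoped ComplexOrder

variable {k : ℕ}

/-! ## §1 The exact-rational tables -/

namespace Model

/-- `(ch)_q = Σ_n c_n h_nq`. -/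
def holeVecH (c : Fin k → ℚ) (F : Model k) (q : Fin k) : ℚ := ∑ n : Fin k, c n * F.h n q

/-- The raw two-body coefficient `A_mqrs = c_m · Σ_n c_n g_nqrs` of `Σ_mn c_m c_n Σ_qrs g_nqrs e_mqrs`. -/
def holeTwoBodyRaw (c : Fin k → ℚ) (F : Model k) (m q r s : Fin k) : ℚ :=
  c m * ∑ n : Fin k, c n * F.eri n q r s

/-- The symmetrised two-body table `(A_pqrs + A_qpsr + A_rspq + A_srqp)/2` (twice the Hermitian-and-pair
average of `A`; the FCIDUMP convention `Ĥ ∋ ½ Σ g e` turns it back into the average). -/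
def holeTwoBody (c : Fin k → ℚ) (F : Model k) (p q r s : Fin k) : ℚ :=
  (holeTwoBodyRaw c F p q r s + holeTwoBodyRaw c F q p s r + holeTwoBodyRaw c F r s p q +
    holeTwoBodyRaw c F s r q p) / 2

/-- **The hole table** `t·𝔾_c − 𝕏_c` (chem-solver-5 DESIGN §4.1; `fcidump_transfer.py` class `hole`
without the `μ·F` part): one-body `t·c_p c_q + ½(c_p (ch)_q + c_q (ch)_p)`, two-body `holeTwoBody`,
core constant `0`. [cite: HelgakerJorgensenOlsen2000, eq. (10.8.20)] -/
def holeTable (c : Fin k → ℚ) (t : ℚ) (F : Model k) : Model k where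
  h p q := t * (c p * c q) + (c p * holeVecH c F q + c q * holeVecH c F p) / 2
  eri := holeTwoBody c F
  ecore := 0

/-- **THE HOLE-TRANSFER TABLE FILE `K = μ·F + t·𝔾_c − 𝕏_c`** = `Model.lincomb μ 1 F (holeTable c t F)`
(tables combined entrywise in `ℚ`; `E_core(K) = μ·E_core(F)`). [cite: HelgakerJorgensenOlsen2000, eq. (10.8.20)] -/
def transferHole (c : Fin k → ℚ) (μ t : ℚ) (F : Model k) : Model k :=
  Model.lincomb μ 1 F (holeTable c t F)

/-- The hole table is symmetric in the minimal sense of `Model.IsSymmetric` (`h_pq = h_qp`,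
`g_pqrs = g_qpsr`) — by construction, for ANY `F`. -/
theorem holeTable_isSymmetric (c : Fin k → ℚ) (t : ℚ) (F : Model k) :
    (holeTable c t F).IsSymmetric := by
  refine ⟨fun p q => ?_, fun p q r s => ?_⟩
  · simp only [holeTable]; ring
  · simp only [holeTable, holeTwoBody]; ring

/-- `K` is symmetric when `F` is (so `Rows/SectorRows.lowerRow_of_certificate` applies to `K`). -/
theorem transferHole_isSymmetric {F : Model k} (hF : F.IsSymmetric) (c : Fin k → ℚ) (μ t : ℚ) :
    (transferHole c μ t F).IsSymmetric :=
  Model.lincomb_isSymmetric hF (holeTable_isSymmetric c t F)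

/-- Tables of `K` (by definition): one-body. -/
theorem transferHole_h (c : Fin k → ℚ) (μ t : ℚ) (F : Model k) (p q : Fin k) :
    (transferHole c μ t F).h p q =
      μ * F.h p q + (t * (c p * c q) + (c p * holeVecH c F q + c q * holeVecH c F p) / 2) := by
  simp [transferHole, Model.lincomb, holeTable]

/-- Tables of `K` (by definition): two-body. -/
theorem transferHole_eri (c : Fin k → ℚ) (μ t : ℚ) (F : Model k) (p q r s : Fin k) :
    (transferHole c μ t F).eri p q r s = μ * F.eri p q r s + holeTwoBody c F p q r s := by
  simp [transferHole, Model.lincomb, holeTable]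

/-- Tables of `K` (by definition): core constant. -/
theorem transferHole_ecore (c : Fin k → ℚ) (μ t : ℚ) (F : Model k) :
    (transferHole c μ t F).ecore = μ * F.ecore := by
  simp [transferHole, Model.lincomb, holeTable]

/-- With the FCIDUMP symmetry `(pq|rs) = (pq|sr)` of `F`, the symmetrised two-body table is invariant
under exchanging its first two indices — hence it EQUALS the 8-term symmetrisation `2·sym8(A)` written
by `fcidump_transfer.py` (`holeTwoBody_eq_sym8`). -/
theorem holeTwoBody_swap {F : Model k} (hF : ∀ p q r s, F.eri p q r s = F.eri p q s r)
    (c : Fin k → ℚ) (p q r s : Fin k) : holeTwoBody c F q p r s = holeTwoBody c F p q r s := by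
  have hcg : ∀ m x y z : Fin k, holeTwoBodyRaw c F m x y z = holeTwoBodyRaw c F m x z y := by
    intro m x y z
    simp only [holeTwoBodyRaw]
    congr 1
    exact Finset.sum_congr rfl fun n _ => by rw [hF n x y z]
  simp only [holeTwoBody]
  rw [hcg q p r s, hcg p q s r, hcg r s q p, hcg s r p q]
  ring

/-- **The typed table IS the tool's table**: for `(pq|rs) = (pq|sr)`,
`holeTwoBody = (A_pqrs + A_qprs + A_pqsr + A_qpsr + A_rspq + A_srpq + A_rsqp + A_srqp)/4 = 2·sym8(A)`
(`fcidump_transfer.py` 0.1.0, `gK = μ·g + 2·sym8_sparse(A2)`). -/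
theorem holeTwoBody_eq_sym8 {F : Model k} (hF : ∀ p q r s, F.eri p q r s = F.eri p q s r)
    (c : Fin k → ℚ) (p q r s : Fin k) :
    holeTwoBody c F p q r s =
      (holeTwoBodyRaw c F p q r s + holeTwoBodyRaw c F q p r s + holeTwoBodyRaw c F p q s r +
        holeTwoBodyRaw c F q p s r + holeTwoBodyRaw c F r s p q + holeTwoBodyRaw c F s r p q +
        holeTwoBodyRaw c F r s q p + holeTwoBodyRaw c F s r q p) / 4 := by
  have h := holeTwoBody_swap hF c p q r s
  simp only [holeTwoBody] at h ⊢
  linarith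

/-- **`K` inherits the full 8-fold rule** (`Model.IsEightfold`, `Rows/ModelPin.lean`) from `F`: it is
a legal `.clean` FCIDUMP model for the readers and for every soundness theorem. -/
theorem transferHole_isEightfold {F : Model k} (hF : F.IsEightfold) (c : Fin k → ℚ) (μ t : ℚ) :
    (transferHole c μ t F).IsEightfold := by
  refine ⟨fun p q => ?_, fun p q r s => ?_, fun p q r s => ?_, fun p q r s => ?_⟩
  · rw [transferHole_h, transferHole_h, hF.1 p q]; ring
  · rw [transferHole_eri, transferHole_eri, hF.2.1 p q r s, holeTwoBody_swap hF.2.2.1 c q p r s]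
  · rw [transferHole_eri, transferHole_eri, hF.2.2.1 p q r s]
    have h1 := holeTwoBody_swap hF.2.2.1 c s r q p
    have h2 : holeTwoBody c F p q s r = holeTwoBody c F r s q p := by simp only [holeTwoBody]; ring
    have h3 : holeTwoBody c F p q r s = holeTwoBody c F s r q p := by simp only [holeTwoBody]; ring
    rw [h2, h3, h1]
  · rw [transferHole_eri, transferHole_eri, hF.2.2.2 p q r s]
    simp only [holeTwoBody]; ring

end Model

/-! ## §2 The operators: hole transfer, its Gram operator, and the commutator operator (HJO 10.8.20) -/

/-- **The hole transfer of spin `σ`**: `a_{cσ} = Σ_q c_q a_{qσ}`. -/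
def holeOp (c : Fin k → ℚ) (σ : Fin 2) : Op k :=
  ∑ q : Fin k, ((c q : ℚ) : ℂ) • annihilation (orb q σ)

/-- **The Gram operator** `G_c = Σ_σ a†_{cσ} a_{cσ}` (its expectation is `Σ_σ ‖a_{cσ}ψ‖²`). -/
def holeGram (c : Fin k → ℚ) : Op k := ∑ σ : Fin 2, (holeOp c σ)ᴴ * holeOp c σ

/-- **The commutator operator** `O = Σ_σ a†_{cσ}(a_{cσ}Ĥ(F) − Ĥ(F)a_{cσ})` (its expectation at a
source eigenvector is MINUS the transferred energy numerator). -/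
def holeCommutatorOp (c : Fin k → ℚ) (F : Model k) : Op k :=
  ∑ σ : Fin 2, (holeOp c σ)ᴴ * (holeOp c σ * F.hamiltonian - F.hamiltonian * holeOp c σ)

/-- A rational cast to `ℂ` is self-adjoint. [folklore] -/
private theorem star_ratCast (x : ℚ) : star ((x : ℚ) : ℂ) = ((x : ℚ) : ℂ) := by
  rw [Complex.star_def, map_ratCast]

/-- Bilinear expansion of a product of two linear combinations of operators. [folklore] -/
private theorem sum_smul_mul_sum_smul (a b : Fin k → ℂ) (X Y : Fin k → Op k) :
    (∑ m : Fin k, a m • X m) * (∑ n : Fin k, b n • Y n) =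
      ∑ m : Fin k, ∑ n : Fin k, (a m * b n) • (X m * Y n) := by
  rw [Finset.sum_mul]
  refine Finset.sum_congr rfl fun m _ => ?_
  rw [Finset.mul_sum]
  refine Finset.sum_congr rfl fun n _ => ?_
  rw [smul_mul_assoc, mul_smul_comm, smul_smul]

/-- The commutator with a linear combination is the linear combination of the commutators. [folklore] -/
private theorem sum_smul_comm_eq (b : Fin k → ℂ) (Y : Fin k → Op k) (H : Op k) :
    (∑ n : Fin k, b n • Y n) * H - H * (∑ n : Fin k, b n • Y n) =
      ∑ n : Fin k, b n • (Y n * H - H * Y n) := by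
  rw [Finset.sum_mul, Finset.mul_sum, ← Finset.sum_sub_distrib]
  refine Finset.sum_congr rfl fun n _ => ?_
  rw [smul_mul_assoc, mul_smul_comm, smul_sub]

/-- Moving a two-valued spin sum inside a double orbital sum. [folklore] -/
private theorem sum_spin_comm (f : Fin 2 → Fin k → Fin k → Op k) :
    ∑ σ : Fin 2, ∑ m : Fin k, ∑ n : Fin k, f σ m n = ∑ m : Fin k, ∑ n : Fin k, ∑ σ : Fin 2, f σ m n := by
  rw [Finset.sum_comm]
  refine Finset.sum_congr rfl fun m _ => ?_
  rw [Finset.sum_comm]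

/-- `a_{cσ}† = Σ_m c_m a†_{mσ}` (`c` rational, hence real). [folklore] -/
theorem holeOp_conjTranspose (c : Fin k → ℚ) (σ : Fin 2) :
    (holeOp c σ)ᴴ = ∑ m : Fin k, ((c m : ℚ) : ℂ) • creation (orb m σ) := by
  simp only [holeOp, conjTranspose_sum, conjTranspose_smul, annihilation_conjTranspose, star_ratCast]

/-- **`G_c = Σ_pq c_p c_q E_pq`.** [folklore] -/
theorem holeGram_eq (c : Fin k → ℚ) :
    holeGram c = ∑ p : Fin k, ∑ q : Fin k, ((c p * c q : ℚ) : ℂ) • singletExcitation p q := by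
  unfold holeGram
  simp_rw [holeOp_conjTranspose]
  unfold holeOp
  simp_rw [sum_smul_mul_sum_smul]
  rw [sum_spin_comm]
  refine Finset.sum_congr rfl fun p _ => Finset.sum_congr rfl fun q _ => ?_
  rw [singletExcitation, Finset.smul_sum, Rat.cast_mul]

/-- **`O = Σ_mn c_m c_n Σ_σ a†_{mσ}(a_{nσ}Ĥ − Ĥa_{nσ})`** (expansion of the commutator operator). [folklore] -/
theorem holeCommutatorOp_expand (c : Fin k → ℚ) (F : Model k) :
    holeCommutatorOp c F = ∑ m : Fin k, ∑ n : Fin k, ((c m * c n : ℚ) : ℂ) •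
      ∑ σ : Fin 2, creation (orb m σ) * (annihilation (orb n σ) * F.hamiltonian -
        F.hamiltonian * annihilation (orb n σ)) := by
  unfold holeCommutatorOp
  simp_rw [holeOp_conjTranspose]
  unfold holeOp
  simp_rw [sum_smul_comm_eq, sum_smul_mul_sum_smul]
  rw [sum_spin_comm]
  refine Finset.sum_congr rfl fun m _ => Finset.sum_congr rfl fun n _ => ?_
  rw [Finset.smul_sum, Rat.cast_mul]

/-- **`O = Σ_mn c_m c_n (Σ_q h_nq E_mq + Σ_qrs g_nqrs e_mqrs)`** for a model whose two-electron table
satisfies `g_pqrs = g_rspq` (pair symmetry; part of the 8-fold rule) — HJO eq. (10.8.20), the tree's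
`sum_creation_mul_commutator_annihilation_hamiltonian`, summed against `c_m c_n`.
[cite: HelgakerJorgensenOlsen2000, eq. (10.8.20)] -/
theorem holeCommutatorOp_eq (c : Fin k → ℚ) {F : Model k}
    (hg : ∀ p q r s, F.eri p q r s = F.eri r s p q) :
    holeCommutatorOp c F =
      ∑ m : Fin k, ∑ n : Fin k, ((c m * c n : ℚ) : ℂ) •
        (∑ q : Fin k, ((F.h n q : ℚ) : ℂ) • singletExcitation m q +
          ∑ q : Fin k, ∑ r : Fin k, ∑ s : Fin k,
            ((F.eri n q r s : ℚ) : ℂ) • twoElectronExcitation m q r s) := by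
  have hg' : ∀ p q r s : Fin k, ((F.eri p q r s : ℚ) : ℂ) = ((F.eri r s p q : ℚ) : ℂ) :=
    fun p q r s => by rw [hg p q r s]
  have hHJO := fun m n => sum_creation_mul_commutator_annihilation_hamiltonian
    (fun p q => ((F.h p q : ℚ) : ℂ)) (g := fun p q r s => ((F.eri p q r s : ℚ) : ℂ))
    ((F.ecore : ℚ) : ℂ) hg' m n
  rw [holeCommutatorOp_expand]
  refine Finset.sum_congr rfl fun m _ => Finset.sum_congr rfl fun n _ => ?_
  rw [show F.hamiltonian = molecularHamiltonian (fun p q => ((F.h p q : ℚ) : ℂ))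
      (fun p q r s => ((F.eri p q r s : ℚ) : ℂ)) ((F.ecore : ℚ) : ℂ) from rfl, hHJO m n]

/-! ### Pair symmetry of `e_pqrs` (used by the sequel) -/

/-- `a_i a_j = −a_j a_i` (pure CAR, the tree's `annihilation_anticommute_holds`). [folklore] -/
private theorem annihilation_mul_annihilation_eq_neg (i j : Orb (Fin k)) :
    (annihilation i : Op k) * annihilation j = -(annihilation j * annihilation i) :=
  eq_neg_of_add_eq_zero_left (annihilation_anticommute_holds (ι := Orb (Fin k)) i j)

/-- **Pair symmetry of the two-electron excitation operator**: `e_pqrs = e_rspq`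
(`a†_{pσ}a†_{rτ}a_{sτ}a_{qσ} = a†_{rτ}a†_{pσ}a_{qσ}a_{sτ}`: two anticommutations). HJO (2000)
eq. (2.2.16) ff. («e_pqrs = e_rspq»). [cite: HelgakerJorgensenOlsen2000, eq. (2.2.16)] -/
theorem twoElectronExcitation_pairSwap (p q r s : Fin k) :
    (twoElectronExcitation p q r s : Op k) = twoElectronExcitation r s p q := by
  unfold twoElectronExcitation
  rw [Finset.sum_comm]
  refine Finset.sum_congr rfl fun τ _ => Finset.sum_congr rfl fun σ _ => ?_
  rw [creation_mul_creation_eq_neg (orb p σ) (orb r τ), neg_mul, neg_mul, mul_assoc,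
    annihilation_mul_annihilation_eq_neg (orb s τ) (orb q σ), mul_neg, neg_neg, ← mul_assoc]

end Summit.Ventures.CertifiedQuantumChemistry

end
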